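import Literature.MathematicalPhysics.QuantumFieldTheory.Balaban1983to89.B6Eq228FaddeevPopov
import Literature.MathematicalPhysics.QuantumFieldTheory.Balaban1983to89.B5ChangeOfGauge123

/-!
# `Balaban1983to89.B6Eq230GaussianRoute` — T. Bałaban, *Propagators and renormalization transformations for lattice
# gauge theories. II*, Commun. Math. Phys. **96** (1984) 223–250 [Balaban1984PropagatorsII], Sect. A (2.29)–(2.31)
# p. 227: the Faddeev–Popov computation (2.30) ASSEMBLED — `∫dA e^{−½⟨A,Δ_aA⟩+⟨f,R∂*A⟩} = e^{½⟨f,Rf⟩}·Z` — and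
# **(2.31) `R∂*G∂R = R` DERIVED BY THE PRINTED GAUSSIAN ROUTE**

statement-level skeleton of published theorems with citation tags; proofs where landed; nothing here is a claim about the Yang–Mills mass gap

PDF held: `paper:balaban1984-cmp96-propagators-rt-ii` (journal page = PDF page + 222); pp. 225–228 read AS IMAGES on
the ×2 renders `run/shared/lean/pub/pub-balaban/b2b-balaban-ref1/pages/1984-cmp96-propagators-rt-II/…-p003…p006-x2.png`
by this seat (2026-08-21).

CITATION HEADER (lean-in-tree rule).  WHAT IS REPRODUCED: lit-balaban SKELETON row **B6.Eq2.31** ((2.28)–(2.31) p. 227;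
head `R∂*G∂R = R` = the ALGEBRAIC theorem of record `…B6Eq231.eq231`, p239491, cell note *"PROVED algebraically (not
via the printed Gaussian integrals (2.28)–(2.30))"*, census C-B6-2).  File 2/4 of the printed Gaussian route by
PHASE-2 seat p22 (gen 4); owner r03, referee ref-4.  IMPORTS, restating nothing: `…B6Eq228FaddeevPopov` (file 1/4:
(2.28), the pointwise lines of (2.30), `form_gauge`, `existsUnique_229`), `…B5ChangeOfGauge123` (this seat, gen 1: the
slice ⊕ gauge-orbit change of variables with its constant Jacobian, `integral_comp_slice_orbit` / `jacobian_pos` —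
part I's (1.23) engine, re-used verbatim for (2.29)), `…B6Eq295` (`eq225`).

PRINT (p. 227 [PDF 5], verbatim; the full display (2.28)–(2.30) is quoted in `…B6Eq228FaddeevPopov`).  *"We have
|det(Δ↾_{N(Q′)})| ∫dλ′δ(Q′λ′)δ_R(R∂*A + Δλ′) = 1 (2.29) (see the proof of the formula (1.46) in [4]) and we insert the
expression above into the integral in (2.28). We change the order of integrations ∫dA∫dλ′… = ∫dλ′∫dA…, next we make
the gauge transformation A → A^{λ′} = A − ∂λ′, and we again change the order of the integrations. Because Q′λ′ = 0,
hence QA^{λ′} = QA − ∂₁Q′λ′ = QA, and we get e^{½⟨f,R∂*G∂Rf⟩} = Z⁻¹|det(Δ↾_{N(Q′)})|Z′∫dA e^{−½‖∂A‖²−½a‖QA‖²}δ_R(R∂*A)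
· … = … · e^{−⟨Δ∂*A,𝒢Δf⟩+½⟨Δf,𝒢Δf⟩} = e^{½⟨f,Rf⟩}. (2.30) The last equality follows from the identity (2.26) and from the
presence of the δ-function δ_R(R∂*A). Thus R∂*G∂R = R. (2.31)"*; p. 226 *"One of our main results will be that the
operator Δ_a is bounded from below by a positive constant"*; p. 228 *"The only assumption we have used was the positivity
of the operator Δ_a, a > 0, or G"*.

TYPING OF (2.29) AND OF THE TWO SWAPS (the convention of `…B5ChangeOfGauge123`, every hypothesis displayed).  The support
of `δ_R(R∂*A)` — the gauge slice `{A₀ : R∂*A₀ = 0}` — is carried by a finite-dimensional space `S` with an additive Haar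
(Lebesgue) measure `μS` and a linear parametrisation `s : S → A` (`hs : R∂*(sA₀) = 0`); the gauge group `N(Q′)` by `N`
with an additive Haar measure `ν` acting through `A^{λ′} = A − ∂λ′` (`dN : N → A`); `dA` is an additive Haar measure `μA`.
The net effect of *"insert (2.29), change the order, gauge transformation, change the order again"* is the change of
variables `(A₀, λ′) ↦ A₀ − ∂λ′`, a linear isomorphism `e : S × N ≃ A` (`he`) — whose EXISTENCE is exactly the statement
that `δ_R(R∂*A + Δλ′)` has one zero per configuration, `…B6Eq228FaddeevPopov.existsUnique_229`, realised here as
`exists_sliceEquiv` on the concrete slice `ker(R∂*)` — with the constant Jacobian `c = addHaarScalarFactor((μS⊗ν)∘e⁻¹,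
μA) > 0` (`fp_decomposition`): the typed content of `|det(Δ↾_{N(Q′)})|` in the chosen flat normalisations.  No Fubini
hypothesis is needed: after the gauge transformation the integrand FACTORISES into a slice factor and an orbit factor
(`integral_prod_mul`).

CONTENTS (all theorems; no definitions; standard axioms).
§1 `fp_decomposition` ((2.29) + the two swaps + the gauge transformation as one change of variables),
   `normalisation_230` (the prefactor `Z⁻¹|det|Z′∫dA e^{…}δ_R(R∂*A)` of (2.30) equals `1`: the case `f = 0`),
   **`eq230`** (`∫dA e^{−½⟨A,Δ_aA⟩+⟨f,R∂*A⟩} = e^{½⟨f,Rf⟩}·Z`, NO integrability hypothesis), `eq230_exp`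
   (`e^{½⟨f,R∂*G∂Rf⟩} = e^{½⟨f,Rf⟩}` under `Z ≠ 0`), **`eq231_gaussian`** ((2.31) by polarisation:
   `LinearMap.IsSymmetric.inner_map_self_eq_zero`).
§2 `Z_pos` (positivity `⟨A,Δ_aA⟩ ≥ γ‖A‖²` ⇒ the Gaussian is integrable and `Z > 0` — the printed standing assumption),
   `exists_sliceEquiv` ((2.29) as coordinates), **`eq231_of_gaussian`** ((2.31) with the slice/orbit data DISCHARGED:
   hypotheses = the printed structure, Δ injective on N(Q′) ((2.11)), and `Z ≠ 0`).
HONEST SCOPE as in file 1/4: abstract carriers; the conclusion has the operator shape of `…B6Eq231.eq231` (theorem of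
record unchanged).  Unit `lit-balaban-p22` (gen 4), HOME `run/shared/lean/pub/lit-balaban/`.
-/

noncomputable section

open MeasureTheory
open scoped InnerProductSpace

namespace Literature.MathematicalPhysics.QuantumFieldTheory.Balaban1983to89.B6Eq230GaussianRoute

open B6Eq228FaddeevPopov

/-! ## §1  (2.29)–(2.30) assembled and (2.31) -/

section Assembly

variable {V A W T S N : Type*} [NormedAddCommGroup V] [InnerProductSpace ℝ V]
  [NormedAddCommGroup A] [InnerProductSpace ℝ A] [FiniteDimensional ℝ A] [MeasurableSpace A] [BorelSpace A]
  [NormedAddCommGroup W] [InnerProductSpace ℝ W] [NormedAddCommGroup T] [InnerProductSpace ℝ T]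
  [NormedAddCommGroup S] [NormedSpace ℝ S] [FiniteDimensional ℝ S] [MeasurableSpace S] [BorelSpace S]
  [NormedAddCommGroup N] [NormedSpace ℝ N] [FiniteDimensional ℝ N] [MeasurableSpace N] [BorelSpace N]

/-- **(2.29) inserted, *"we change the order of integrations …, next we make the gauge transformation A → A^{λ′} =
A − ∂λ′, and we again change the order of the integrations"* — as ONE change of variables.**  With the slice
`{R∂*A = 0}` (the support of `δ_R(R∂*A)`) carried by `(S, μS, s)` and slice ⊕ gauge-orbit coordinates
`e(A₀, λ′) = A₀ − ∂λ′` of the configuration space (a linear isomorphism by `existsUnique_229`), for additive Haar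
(Lebesgue) measures: `∫∫ Φ(A₀ − ∂λ′) dμS dν = c · ∫dA Φ(A)`, `c = addHaarScalarFactor((μS ⊗ ν)∘e⁻¹, dA) > 0` — the
constant `|det(Δ↾N(Q′))|⁻¹`-type Jacobian of print in the chosen normalisations (`…B5ChangeOfGauge123` §2).
[cite: Balaban1984PropagatorsII, (2.29)–(2.30) p.227] -/
theorem fp_decomposition (μS : Measure S) (ν : Measure N) (μA : Measure A) [μS.IsAddHaarMeasure]
    [ν.IsAddHaarMeasure] [μA.IsAddHaarMeasure] (e : (S × N) ≃L[ℝ] A) (s : S →ₗ[ℝ] A) (dN : N →ₗ[ℝ] A)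
    (he : ∀ m l, e (m, l) = s m - dN l) (Φ : A → ℝ) :
    ∫ p, Φ (s p.1 - dN p.2) ∂(μS.prod ν) =
      (Measure.addHaarScalarFactor ((μS.prod ν).map e) μA : ℝ) * ∫ v, Φ v ∂μA := by
  have h := B5ChangeOfGauge123.integral_comp_slice_orbit μS ν μA e Φ
  have hfun : (fun p : S × N => Φ (e p)) = fun p => Φ (s p.1 - dN p.2) := by
    funext p; rw [← he p.1 p.2]
  rw [hfun] at h
  rw [h, smul_eq_mul]

/-- **The prefactor of (2.30) is `1`:** `Z⁻¹|det(Δ↾N(Q′))|Z′∫dA e^{−½‖∂A‖²−½a‖QA‖²}δ_R(R∂*A) = 1`, i.e. in the typed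
normalisations `c · Z = (∫_{slice} e^{−½‖∂A₀‖²−½⟨QA₀,aQA₀⟩} dμS) · Z′` — the case `f = 0` of the computation (2.30).
[cite: Balaban1984PropagatorsII, (2.30) p.227] -/
theorem normalisation_230 (μS : Measure S) (ν : Measure N) (μA : Measure A) [μS.IsAddHaarMeasure]
    [ν.IsAddHaarMeasure] [μA.IsAddHaarMeasure] (e : (S × N) ≃L[ℝ] A) (s : S →ₗ[ℝ] A) (dN : N →ₗ[ℝ] A)
    (he : ∀ m l, e (m, l) = s m - dN l) (M : A →ₗ[ℝ] A) (curl : A →ₗ[ℝ] T) (dstar : A →ₗ[ℝ] V)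
    (Rp : V →ₗ[ℝ] V) (Q : A →ₗ[ℝ] W) (a : W →ₗ[ℝ] W) (D : N →ₗ[ℝ] V) (K : Submodule ℝ V)
    [K.HasOrthogonalProjection] (hK : LinearMap.range D = K) (hR : ∀ g, Rp g = K.starProjection g)
    (hform : ∀ v, ⟪v, M v⟫_ℝ = ‖curl v‖ ^ 2 + ⟪dstar v, Rp (dstar v)⟫_ℝ + ⟪Q v, a (Q v)⟫_ℝ)
    (hcurl : ∀ l, curl (dN l) = 0) (hQ : ∀ l, Q (dN l) = 0) (hD : ∀ l, dstar (dN l) = D l)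
    (hs : ∀ m, Rp (dstar (s m)) = 0) :
    (Measure.addHaarScalarFactor ((μS.prod ν).map e) μA : ℝ) * ∫ v, Real.exp (-(1 / 2) * ⟪v, M v⟫_ℝ) ∂μA =
      (∫ m, Real.exp (-(1 / 2) * ‖curl (s m)‖ ^ 2 - (1 / 2) * ⟪Q (s m), a (Q (s m))⟫_ℝ) ∂μS) *
        ∫ l, Real.exp (-(1 / 2) * ‖D l‖ ^ 2) ∂ν := by
  have hdec := fp_decomposition μS ν μA e s dN he (fun v => Real.exp (-(1 / 2) * ⟪v, M v⟫_ℝ))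
  rw [← hdec]
  have hpt : ∀ p : S × N, Real.exp (-(1 / 2) * ⟪s p.1 - dN p.2, M (s p.1 - dN p.2)⟫_ℝ) =
      Real.exp (-(1 / 2) * ‖curl (s p.1)‖ ^ 2 - (1 / 2) * ⟪Q (s p.1), a (Q (s p.1))⟫_ℝ) *
        Real.exp (-(1 / 2) * ‖D p.2‖ ^ 2) := by
    intro p
    rw [form_gauge M curl dstar Rp Q a D dN K hK hR hform hcurl hQ hD (hs p.1) p.2, ← Real.exp_add]
    congr 1; ring
  simp_rw [hpt]
  exact integral_prod_mul (fun m : S => Real.exp (-(1 / 2) * ‖curl (s m)‖ ^ 2 - (1 / 2) * ⟪Q (s m), a (Q (s m))⟫_ℝ))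
    (fun l : N => Real.exp (-(1 / 2) * ‖D l‖ ^ 2))

/-- **(2.30), assembled:** `∫dA e^{−½⟨A,Δ_aA⟩ + ⟨f,R∂*A⟩} = e^{½⟨f,Rf⟩} · Z` — the printed computation: Faddeev–Popov
decomposition of `dA` into slice ⊕ orbit (2.29), gauge invariance of `‖∂A‖²`, `‖QA‖²`, the orbit Gaussian integrals by
(2.25)/(2.26), and the normalisation `f = 0`.  No integrability hypothesis: additive Haar measures on finite-dimensional
carriers, every integrand as printed. [cite: Balaban1984PropagatorsII, (2.30) p.227] -/
theorem eq230 (μS : Measure S) (ν : Measure N) (μA : Measure A) [μS.IsAddHaarMeasure]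
    [ν.IsAddHaarMeasure] [μA.IsAddHaarMeasure] (e : (S × N) ≃L[ℝ] A) (s : S →ₗ[ℝ] A) (dN : N →ₗ[ℝ] A)
    (he : ∀ m l, e (m, l) = s m - dN l) (M : A →ₗ[ℝ] A) (curl : A →ₗ[ℝ] T) (dstar : A →ₗ[ℝ] V)
    (Rp : V →ₗ[ℝ] V) (Q : A →ₗ[ℝ] W) (a : W →ₗ[ℝ] W) (D : N →ₗ[ℝ] V) (K : Submodule ℝ V)
    [K.HasOrthogonalProjection] (hK : LinearMap.range D = K) (hR : ∀ g, Rp g = K.starProjection g)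
    (hform : ∀ v, ⟪v, M v⟫_ℝ = ‖curl v‖ ^ 2 + ⟪dstar v, Rp (dstar v)⟫_ℝ + ⟪Q v, a (Q v)⟫_ℝ)
    (hcurl : ∀ l, curl (dN l) = 0) (hQ : ∀ l, Q (dN l) = 0) (hD : ∀ l, dstar (dN l) = D l)
    (hs : ∀ m, Rp (dstar (s m)) = 0) (f : V) :
    ∫ v, Real.exp (-(1 / 2) * ⟪v, M v⟫_ℝ + ⟪f, Rp (dstar v)⟫_ℝ) ∂μA =
      Real.exp ((1 / 2) * ⟪f, Rp f⟫_ℝ) * ∫ v, Real.exp (-(1 / 2) * ⟪v, M v⟫_ℝ) ∂μA := by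
  set c : ℝ := (Measure.addHaarScalarFactor ((μS.prod ν).map e) μA : ℝ) with hc
  have hcpos : 0 < c := by rw [hc]; exact_mod_cast B5ChangeOfGauge123.jacobian_pos μS ν μA e
  -- `c · ∫ I₁ = (∫_slice w) · e^{½⟨f,Rf⟩} Z′`
  have h1 : c * ∫ v, Real.exp (-(1 / 2) * ⟪v, M v⟫_ℝ + ⟪f, Rp (dstar v)⟫_ℝ) ∂μA =
      (∫ m, Real.exp (-(1 / 2) * ‖curl (s m)‖ ^ 2 - (1 / 2) * ⟪Q (s m), a (Q (s m))⟫_ℝ) ∂μS) *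
        (Real.exp ((1 / 2) * ⟪f, Rp f⟫_ℝ) * ∫ l, Real.exp (-(1 / 2) * ‖D l‖ ^ 2) ∂ν) := by
    rw [hc, ← fp_decomposition μS ν μA e s dN he]
    have hpt : ∀ p : S × N,
        Real.exp (-(1 / 2) * ⟪s p.1 - dN p.2, M (s p.1 - dN p.2)⟫_ℝ + ⟪f, Rp (dstar (s p.1 - dN p.2))⟫_ℝ) =
        Real.exp (-(1 / 2) * ‖curl (s p.1)‖ ^ 2 - (1 / 2) * ⟪Q (s p.1), a (Q (s p.1))⟫_ℝ) *
          Real.exp (-(1 / 2) * ‖D p.2‖ ^ 2 + ⟪-f, D p.2⟫_ℝ) := by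
      intro p
      rw [form_gauge M curl dstar Rp Q a D dN K hK hR hform hcurl hQ hD (hs p.1) p.2,
        R_dstar_gauge D K hK Rp hR dstar dN hD (s p.1) p.2, hs, zero_sub, inner_neg_right, inner_neg_left,
        ← Real.exp_add]
      congr 1; ring
    simp_rw [hpt]
    rw [integral_prod_mul (fun m : S => Real.exp (-(1 / 2) * ‖curl (s m)‖ ^ 2 - (1 / 2) * ⟪Q (s m), a (Q (s m))⟫_ℝ))
      (fun l : N => Real.exp (-(1 / 2) * ‖D l‖ ^ 2 + ⟪-f, D l⟫_ℝ)),
      B6Eq295.eq225 ν D K hK Rp hR (-f), map_neg, inner_neg_right, inner_neg_left, neg_neg]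
  have h0 := normalisation_230 μS ν μA e s dN he M curl dstar Rp Q a D K hK hR hform hcurl hQ hD hs
  -- combine: c·∫I₁ = e^{½⟨f,Rf⟩}·(c·Z)
  have h2 : c * ∫ v, Real.exp (-(1 / 2) * ⟪v, M v⟫_ℝ + ⟪f, Rp (dstar v)⟫_ℝ) ∂μA =
      c * (Real.exp ((1 / 2) * ⟪f, Rp f⟫_ℝ) * ∫ v, Real.exp (-(1 / 2) * ⟪v, M v⟫_ℝ) ∂μA) := by
    rw [h1, ← mul_assoc c, mul_comm c (Real.exp _), mul_assoc (Real.exp _) c, hc, h0]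
    ring
  exact mul_left_cancel₀ hcpos.ne' h2

/-- **(2.30) in the printed letters:** `e^{½⟨f,R∂*G∂Rf⟩} = e^{½⟨f,Rf⟩}`, provided `Z ≠ 0` (the Gaussian of `Δ_a` is a
genuine, convergent integral — *"One of our main results will be that the operator Δ_a is bounded from below by a
positive constant"*, p. 226; see `Z_pos` below). [cite: Balaban1984PropagatorsII, (2.30) p.227] -/
theorem eq230_exp (μS : Measure S) (ν : Measure N) (μA : Measure A) [μS.IsAddHaarMeasure]
    [ν.IsAddHaarMeasure] [μA.IsAddHaarMeasure] (e : (S × N) ≃L[ℝ] A) (s : S →ₗ[ℝ] A) (dN : N →ₗ[ℝ] A)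
    (he : ∀ m l, e (m, l) = s m - dN l) (M G : A →ₗ[ℝ] A) (curl : A →ₗ[ℝ] T) (d : V →ₗ[ℝ] A)
    (dstar : A →ₗ[ℝ] V) (Rp : V →ₗ[ℝ] V) (Q : A →ₗ[ℝ] W) (a : W →ₗ[ℝ] W) (D : N →ₗ[ℝ] V)
    (K : Submodule ℝ V) [K.HasOrthogonalProjection] (hK : LinearMap.range D = K)
    (hR : ∀ g, Rp g = K.starProjection g) (hadj : ∀ (v : A) (g : V), ⟪v, d g⟫_ℝ = ⟪dstar v, g⟫_ℝ)
    (hM : ∀ x y : A, ⟪M x, y⟫_ℝ = ⟪x, M y⟫_ℝ) (hMG : M ∘ₗ G = LinearMap.id)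
    (hform : ∀ v, ⟪v, M v⟫_ℝ = ‖curl v‖ ^ 2 + ⟪dstar v, Rp (dstar v)⟫_ℝ + ⟪Q v, a (Q v)⟫_ℝ)
    (hcurl : ∀ l, curl (dN l) = 0) (hQ : ∀ l, Q (dN l) = 0) (hD : ∀ l, dstar (dN l) = D l)
    (hs : ∀ m, Rp (dstar (s m)) = 0) (hZ : ∫ v, Real.exp (-(1 / 2) * ⟪v, M v⟫_ℝ) ∂μA ≠ 0) (f : V) :
    Real.exp ((1 / 2) * ⟪f, (Rp ∘ₗ dstar ∘ₗ G ∘ₗ d ∘ₗ Rp) f⟫_ℝ) = Real.exp ((1 / 2) * ⟪f, Rp f⟫_ℝ) := by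
  have h := eq228_first μA M G d dstar Rp K hR hadj hM hMG f
  rw [eq230 μS ν μA e s dN he M curl dstar Rp Q a D K hK hR hform hcurl hQ hD hs f] at h
  exact mul_right_cancel₀ hZ h

/-- **(2.31) `R∂*G∂R = R` — DERIVED BY THE PRINTED GAUSSIAN ROUTE (2.28)–(2.30)** (*"Thus R∂*G∂R = R. (2.31)"*):
both sides are symmetric operators with equal quadratic forms `⟨f,R∂*G∂Rf⟩ = ⟨f,Rf⟩` for all `f` (polarisation).  Same
operator shape as the algebraic theorem of record `…B6Eq231.eq231`. [cite: Balaban1984PropagatorsII, (2.31) p.227] -/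
theorem eq231_gaussian (μS : Measure S) (ν : Measure N) (μA : Measure A) [μS.IsAddHaarMeasure]
    [ν.IsAddHaarMeasure] [μA.IsAddHaarMeasure] (e : (S × N) ≃L[ℝ] A) (s : S →ₗ[ℝ] A) (dN : N →ₗ[ℝ] A)
    (he : ∀ m l, e (m, l) = s m - dN l) (M G : A →ₗ[ℝ] A) (curl : A →ₗ[ℝ] T) (d : V →ₗ[ℝ] A)
    (dstar : A →ₗ[ℝ] V) (Rp : V →ₗ[ℝ] V) (Q : A →ₗ[ℝ] W) (a : W →ₗ[ℝ] W) (D : N →ₗ[ℝ] V)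
    (K : Submodule ℝ V) [K.HasOrthogonalProjection] (hK : LinearMap.range D = K)
    (hR : ∀ g, Rp g = K.starProjection g) (hadj : ∀ (v : A) (g : V), ⟪v, d g⟫_ℝ = ⟪dstar v, g⟫_ℝ)
    (hM : ∀ x y : A, ⟪M x, y⟫_ℝ = ⟪x, M y⟫_ℝ) (hMG : M ∘ₗ G = LinearMap.id)
    (hform : ∀ v, ⟪v, M v⟫_ℝ = ‖curl v‖ ^ 2 + ⟪dstar v, Rp (dstar v)⟫_ℝ + ⟪Q v, a (Q v)⟫_ℝ)
    (hcurl : ∀ l, curl (dN l) = 0) (hQ : ∀ l, Q (dN l) = 0) (hD : ∀ l, dstar (dN l) = D l)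
    (hs : ∀ m, Rp (dstar (s m)) = 0) (hZ : ∫ v, Real.exp (-(1 / 2) * ⟪v, M v⟫_ℝ) ∂μA ≠ 0) :
    Rp ∘ₗ dstar ∘ₗ G ∘ₗ d ∘ₗ Rp = Rp := by
  -- equal quadratic forms
  have hq : ∀ f, ⟪f, (Rp ∘ₗ dstar ∘ₗ G ∘ₗ d ∘ₗ Rp) f⟫_ℝ = ⟪f, Rp f⟫_ℝ := by
    intro f
    have h := eq230_exp μS ν μA e s dN he M G curl d dstar Rp Q a D K hK hR hadj hM hMG hform hcurl hQ hD hs hZ f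
    have h' := Real.exp_injective h
    linarith
  -- both operators symmetric ⇒ the difference is a symmetric operator with vanishing quadratic form
  have hS : ∀ x y, ⟪(Rp ∘ₗ dstar ∘ₗ G ∘ₗ d ∘ₗ Rp) x, y⟫_ℝ = ⟪x, (Rp ∘ₗ dstar ∘ₗ G ∘ₗ d ∘ₗ Rp) y⟫_ℝ := by
    intro x y
    simp only [LinearMap.coe_comp, Function.comp_apply]
    calc ⟪Rp (dstar (G (d (Rp x)))), y⟫_ℝ = ⟪dstar (G (d (Rp x))), Rp y⟫_ℝ := R_symm K Rp hR _ _
      _ = ⟪G (d (Rp x)), d (Rp y)⟫_ℝ := (hadj _ _).symm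
      _ = ⟪d (Rp x), G (d (Rp y))⟫_ℝ := G_symm M G hM hMG _ _
      _ = ⟪G (d (Rp y)), d (Rp x)⟫_ℝ := real_inner_comm _ _
      _ = ⟪dstar (G (d (Rp y))), Rp x⟫_ℝ := hadj _ _
      _ = ⟪Rp x, dstar (G (d (Rp y)))⟫_ℝ := real_inner_comm _ _
      _ = ⟪x, Rp (dstar (G (d (Rp y))))⟫_ℝ := R_symm K Rp hR _ _
  have hsymm : (Rp ∘ₗ dstar ∘ₗ G ∘ₗ d ∘ₗ Rp - Rp).IsSymmetric := by
    intro x y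
    rw [LinearMap.sub_apply, LinearMap.sub_apply, inner_sub_left, inner_sub_right, hS, R_symm K Rp hR]
  have hzero : ∀ x, ⟪(Rp ∘ₗ dstar ∘ₗ G ∘ₗ d ∘ₗ Rp - Rp) x, x⟫_ℝ = 0 := by
    intro x
    rw [LinearMap.sub_apply, inner_sub_left, hS, R_symm K Rp hR, hq, sub_self]
  exact sub_eq_zero.mp (hsymm.inner_map_self_eq_zero.mp hzero)

end Assembly

/-! ## §2  Discharging the data: positivity of `Δ_a` ⇒ `Z ≠ 0`; slice ⊕ orbit coordinates from (2.29) -/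

section Discharge

variable {V A W T N : Type*} [NormedAddCommGroup V] [InnerProductSpace ℝ V]
  [NormedAddCommGroup A] [InnerProductSpace ℝ A] [FiniteDimensional ℝ A] [MeasurableSpace A] [BorelSpace A]
  [NormedAddCommGroup W] [InnerProductSpace ℝ W] [NormedAddCommGroup T] [InnerProductSpace ℝ T]
  [NormedAddCommGroup N] [NormedSpace ℝ N] [FiniteDimensional ℝ N]

omit [FiniteDimensional ℝ N] in
/-- *"One of our main results will be that the operator Δ_a is bounded from below by a positive constant"* (p. 226),
*"The only assumption we have used was the positivity of the operator Δ_a"* (p. 228): if `⟨A,Δ_aA⟩ ≥ γ‖A‖²`, `γ > 0`,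
then the Gaussian normalisation `Z = ∫dA e^{−½⟨A,Δ_aA⟩}` is a convergent, strictly positive integral (Lebesgue = additive
Haar measure on the finite-dimensional configuration space). [cite: Balaban1984PropagatorsII, (2.28) p.227] -/
theorem Z_pos (μA : Measure A) [μA.IsAddHaarMeasure] (M : A →ₗ[ℝ] A) {γ : ℝ} (hγ : 0 < γ)
    (hpos : ∀ v, γ * ‖v‖ ^ 2 ≤ ⟪v, M v⟫_ℝ) :
    Integrable (fun v => Real.exp (-(1 / 2) * ⟪v, M v⟫_ℝ)) μA ∧ 0 < ∫ v, Real.exp (-(1 / 2) * ⟪v, M v⟫_ℝ) ∂μA := by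
  -- the comparison Gaussian `e^{−(γ/2)‖v‖²}` is integrable for the canonical volume, hence for `μA = c • volume`
  have hvol : Integrable (fun v : A => Real.exp (-(γ / 2) * ‖v‖ ^ 2)) volume := by
    have h := (GaussianFourier.integrable_cexp_neg_mul_sq_norm_add (V := A) (b := (γ / 2 : ℝ))
      (by simpa using half_pos hγ) 0 0).norm
    refine h.congr (ae_of_all _ fun v => ?_)
    simp only [zero_mul, add_zero, Complex.norm_exp]
    congr 1
    rw [show -((γ / 2 : ℝ) : ℂ) * (‖v‖ : ℂ) ^ 2 = ((-(γ / 2) * ‖v‖ ^ 2 : ℝ) : ℂ) by push_cast; ring]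
    exact Complex.ofReal_re _
  have hμ : μA = Measure.addHaarScalarFactor μA volume • (volume : Measure A) :=
    Measure.isAddLeftInvariant_eq_smul μA volume
  have hcmp : Integrable (fun v : A => Real.exp (-(γ / 2) * ‖v‖ ^ 2)) μA := by
    rw [hμ]; exact hvol.smul_measure (by simp)
  have hcont : Continuous fun v : A => Real.exp (-(1 / 2) * ⟪v, M v⟫_ℝ) :=
    (continuous_const.mul (continuous_id.inner M.continuous_of_finiteDimensional)).rexp
  have hint : Integrable (fun v => Real.exp (-(1 / 2) * ⟪v, M v⟫_ℝ)) μA := by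
    refine hcmp.mono' hcont.aestronglyMeasurable (ae_of_all _ fun v => ?_)
    rw [Real.norm_eq_abs, abs_of_pos (Real.exp_pos _)]
    exact Real.exp_le_exp.mpr (by nlinarith [hpos v])
  refine ⟨hint, ?_⟩
  rw [integral_pos_iff_support_of_nonneg (fun v => (Real.exp_pos _).le) hint]
  have hsupp : Function.support (fun v : A => Real.exp (-(1 / 2) * ⟪v, M v⟫_ℝ)) = Set.univ :=
    Set.eq_univ_of_forall fun v => (Real.exp_pos _).ne'
  rw [hsupp]
  exact isOpen_univ.measure_pos μA Set.univ_nonempty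

omit [MeasurableSpace A] [BorelSpace A] in
/-- **(2.29) as coordinates of the configuration space:** the slice `{R∂*A = 0}` (support of `δ_R(R∂*A)`) and the
gauge orbits `∂N(Q′)` are complementary — `(A₀, λ′) ↦ A₀ − ∂λ′` is a linear isomorphism onto the configurations —
because `δ_R(R∂*A + Δλ′)` has exactly one zero `λ′` for each `A` (`existsUnique_229`: Δ injective on `N(Q′)` with
range `ΔN(Q′)`). [cite: Balaban1984PropagatorsII, (2.29) p.227] -/
theorem exists_sliceEquiv (dstar : A →ₗ[ℝ] V) (Rp : V →ₗ[ℝ] V) (D : N →ₗ[ℝ] V) (dN : N →ₗ[ℝ] A)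
    (K : Submodule ℝ V) [K.HasOrthogonalProjection] (hK : LinearMap.range D = K)
    (hR : ∀ g, Rp g = K.starProjection g) (hD : ∀ l, dstar (dN l) = D l) (hDinj : Function.Injective D) :
    ∃ e : (↥(LinearMap.ker (Rp ∘ₗ dstar)) × N) ≃L[ℝ] A, ∀ m l, e (m, l) = (m : A) - dN l := by
  set Sl := LinearMap.ker (Rp ∘ₗ dstar) with hSl
  let E : (↥Sl × N) →ₗ[ℝ] A := Sl.subtype ∘ₗ LinearMap.fst ℝ (↥Sl) N - dN ∘ₗ LinearMap.snd ℝ (↥Sl) N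
  have hE : ∀ (m : ↥Sl) (l : N), E (m, l) = (m : A) - dN l := fun m l => rfl
  have hinj : Function.Injective E := by
    rw [← LinearMap.ker_eq_bot, LinearMap.ker_eq_bot']
    rintro ⟨m, l⟩ h
    rw [hE, sub_eq_zero] at h
    have hm : Rp (dstar (m : A)) = 0 := LinearMap.map_coe_ker (Rp ∘ₗ dstar) m
    have hl : D l = 0 := by
      rw [h, hD, R_apply_D D K hK Rp hR] at hm; exact hm
    have hl0 : l = 0 := hDinj (by rw [hl, map_zero])
    have hm0 : (m : A) = 0 := by rw [h, hl0, map_zero]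
    ext <;> simp [hl0, hm0]
  have hsurj : Function.Surjective E := by
    intro v
    obtain ⟨l, hl, -⟩ := existsUnique_229 D K hK Rp hR hDinj (dstar v)
    have hmem : v + dN l ∈ Sl := by
      show (Rp ∘ₗ dstar) (v + dN l) = 0
      rw [LinearMap.comp_apply, map_add, map_add, hD, R_apply_D D K hK Rp hR]
      exact hl
    exact ⟨(⟨v + dN l, hmem⟩, l), by rw [hE]; simp⟩
  exact ⟨(LinearEquiv.ofBijective E ⟨hinj, hsurj⟩).toContinuousLinearEquiv, fun m l => rfl⟩

end Discharge

section Headline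

variable {V A W T N : Type*} [NormedAddCommGroup V] [InnerProductSpace ℝ V]
  [NormedAddCommGroup A] [InnerProductSpace ℝ A] [FiniteDimensional ℝ A] [MeasurableSpace A] [BorelSpace A]
  [NormedAddCommGroup W] [InnerProductSpace ℝ W] [NormedAddCommGroup T] [InnerProductSpace ℝ T]
  [NormedAddCommGroup N] [NormedSpace ℝ N] [FiniteDimensional ℝ N]

/-- **(2.31) `R∂*G∂R = R` by the Gaussian route, with the Faddeev–Popov data discharged:** hypotheses = the printed
structure only — `Δ_a = ‖∂·‖² + ⟨∂*·,R∂*·⟩ + ⟨Q·,aQ·⟩` as a form ((2.19)), symmetric, `G = Δ_a⁻¹`, `R` the orthogonal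
projection onto `ΔN(Q′)` ((2.10)), `Δ = ∂*∂` injective on `N(Q′)` ((2.11)), `∂∂λ = 0`, `Q∂λ = 0` on `N(Q′)` ((2.6)–(2.7)),
and `Z = ∫dA e^{−½⟨A,Δ_aA⟩} ≠ 0` (positivity of `Δ_a`, `Z_pos`); the Lebesgue measures on the slice and on `N(Q′)` are
chosen internally (they cancel). [cite: Balaban1984PropagatorsII, (2.31) p.227] -/
theorem eq231_of_gaussian (μA : Measure A) [μA.IsAddHaarMeasure] (M G : A →ₗ[ℝ] A) (curl : A →ₗ[ℝ] T)
    (d : V →ₗ[ℝ] A) (dstar : A →ₗ[ℝ] V) (Rp : V →ₗ[ℝ] V) (Q : A →ₗ[ℝ] W) (a : W →ₗ[ℝ] W) (D : N →ₗ[ℝ] V)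
    (dN : N →ₗ[ℝ] A) (K : Submodule ℝ V) [K.HasOrthogonalProjection] (hK : LinearMap.range D = K)
    (hR : ∀ g, Rp g = K.starProjection g) (hadj : ∀ (v : A) (g : V), ⟪v, d g⟫_ℝ = ⟪dstar v, g⟫_ℝ)
    (hM : ∀ x y : A, ⟪M x, y⟫_ℝ = ⟪x, M y⟫_ℝ) (hMG : M ∘ₗ G = LinearMap.id)
    (hform : ∀ v, ⟪v, M v⟫_ℝ = ‖curl v‖ ^ 2 + ⟪dstar v, Rp (dstar v)⟫_ℝ + ⟪Q v, a (Q v)⟫_ℝ)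
    (hcurl : ∀ l, curl (dN l) = 0) (hQ : ∀ l, Q (dN l) = 0) (hD : ∀ l, dstar (dN l) = D l)
    (hDinj : Function.Injective D) (hZ : ∫ v, Real.exp (-(1 / 2) * ⟪v, M v⟫_ℝ) ∂μA ≠ 0) :
    Rp ∘ₗ dstar ∘ₗ G ∘ₗ d ∘ₗ Rp = Rp := by
  borelize N
  obtain ⟨e, he⟩ := exists_sliceEquiv dstar Rp D dN K hK hR hD hDinj
  exact eq231_gaussian (Measure.addHaar) (Measure.addHaar) μA e (LinearMap.ker (Rp ∘ₗ dstar)).subtype dN he M G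
    curl d dstar Rp Q a D K hK hR hadj hM hMG hform hcurl hQ hD (fun m => LinearMap.map_coe_ker (Rp ∘ₗ dstar) m) hZ

end Headline

end Literature.MathematicalPhysics.QuantumFieldTheory.Balaban1983to89.B6Eq230GaussianRoute

end
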